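/-
Copyright (c) 2026 the pub-hodgecm-mathlib formalisation cell (harness21).  Prover seat hodgecm-mathlib-F0P2-p06 (g12), 2026-09-01.  Road «S3-ram» seeding wave (LEAD F0P3a-plan (g12)
T11-41; owner F0P3a-p06 (g15)); EVIDENCE (b) of A-p16 (g31)'s P-1-ram skeleton `DepthZeroKappaTransferTypeOneRamified.skeleton` 3e7707ef9329d3c8: `stub_chiOne_vanishes_ram`.
-/
import Literature.NumberTheory.Rogawski1990.DepthZeroTransferHValuesTypeOne                          -- ★ p846285: `apply_mem_integer_of_mem`, `red_eq_red_of_valuation_sub_lt_one` (place-generic §1–§2)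
import Literature.NumberTheory.Automorphic.Liu2021.LemD1AsPrintedIndexedNonVacuityRamifiedConverse    -- ★ `valued_galAdicCompletionMap_sub_lt_one_of_ramified` (`σ_w ≡ id (mod 𝔪_w)` at a ramified place)
import Literature.NumberTheory.Automorphic.CMLocalRankOneClassMapOpen                                -- ★ `placeForm_antidiagTwo_eq`
import HarnessLib

/-!
# At a TAME-RAMIFIED non-split place every residually-unipotent element of `K₂ = U(Φ₂)_v ∩ GL₂(𝒪_w)` is residually TRIVIAL

Topic `NumberTheory/Automorphic`; namespace `Literature.NumberTheory.Automorphic.UnitaryGroup`.  KERNEL MATHEMATICS ONLY: theorems, no definition, no named fact,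
no `sorry`, no instance, no notation.  Cell `pub/hodgecm-mathlib`, crux H413 = `stmt-HodgeConjecture-24833`; road «S3-ram» seeding wave (LEAD F0P3a-plan (g12) T11-41;
owner∕table F0P3a-p06 (g15) `S3RAM-ORGANS.md`); organ **«χ₁-VANISHING-ram» = EVIDENCE (b)** of A-p16 (g31)'s P-1-ram skeleton
`F0/P3a/A-p16/g31/DepthZeroKappaTransferTypeOneRamified.skeleton.A-p16g31.lean` (3e7707ef9329d3c8): its `stub_chiOne_vanishes_ram :82` is the head of §2 below,
TOKEN FOR TOKEN (so the skeleton closes it by `exact`).  HONEST LABEL: HC_CM is proved only modulo the cell's 2 remaining named inputs (hLiu418 24832, h413 24833) until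
rung 0 closes; «S3-ram» is Literature seeding with no books consequence; this file discharges nothing by itself.

THE MATHEMATICS ([Rogawski1990] §3.9–§3.10, §4.9 p. 55; [Serre1979] Ch. I §7–§8).  `L` CM, `v` a finite place of `L⁺` NON-SPLIT in `L` (`w ∣ v`, `c • w = w`) and
RAMIFIED (`e(w|v) ≠ 1`), `2 ∈ 𝒪_w^×`.  Then `σ_w ≡ id (mod 𝔪_w)` on `𝒪_w` (★ `valued_galAdicCompletionMap_sub_lt_one_of_ramified`), so the reduction `h̄` of the
`w`-component `h_{2,w} ∈ U(Φ₂)(L_w) ∩ GL₂(𝒪_w)` of any `h ∈ K_H = K₂ × K₁` lies in the ORTHOGONAL group of the split symmetric form `Φ̄₂ = antidiag(1, 1)` over the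
residue field `𝓀_w` (`char 𝓀_w ≠ 2`): `h̄ᵀ Φ̄₂ h̄ = Φ̄₂`.  In `O₂(𝓀)`, `q` odd, a unipotent element is trivial: writing `h̄ = [[a, b], [c, d]]`, orthogonality reads
`2ac = 0`, `2bd = 0`, `ad + bc = 1`, and `(h̄ − 1)² = 0` reads `(a−1)² + bc = 0`, `bc + (d−1)² = 0`; if `a = 0` then `bc = 1`, `d = 0` and `bc + 1 = 2 ≠ 0` — absurd;
so `c = 0`, `ad = 1`, `b = 0`, `(a−1)² = (d−1)² = 0`, i.e. **`h̄ = 1`**.  Consequence for the ramified type-(1) clause (architect A-p16 (g31) finding (b)): END's inert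
class function `χ₁ = 1_{K_H}·[(h̄ − 1)² = 0 ∧ rank(h̄ − 1) = 1]` is the ZERO function on `K_H` at a tame-ramified `w`, and `χ₀ = 1_{K_H}` on residually-unipotent points.

* §1 generic (any field `k`, `(2 : k) ≠ 0`): **`eq_one_of_transpose_mul_swap_mul_eq_of_sq_sub_one_eq_zero`** — `Xᵀ·antidiag(1,1)·X = antidiag(1,1)`, `(X − 1)² = 0 ⇒ X = 1`.
* §2 the place `w`: `red_galAdicCompletionMap_eq_of_ramified` (`red (σ_w x) = red x` on `𝒪_w`), `redMat_map_galAdicCompletionMap_eq_of_ramified` (matrix form),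
  `redMat_transpose_mul_swap_mul_eq_of_mem` (the reduction of `h_{2,w}` is `Φ̄₂`-orthogonal), and the HEAD **`redMat_eq_one_of_sq_sub_one_eq_zero_of_ramified`**
  = the skeleton's `stub_chiOne_vanishes_ram` VERBATIM.

## References
* [Rogawski1990] J. D. Rogawski, *Automorphic Representations of Unitary Groups in Three Variables*, Ann. of Math. Stud. 123 (1990), §3.9–§3.10 (ramified unitary
  groups, special vertices); §4.9 p. 55.
* [Serre1979] J.-P. Serre, *Local Fields*, GTM 67 (1979), Ch. I §7–§8 (tame inertia acts trivially on the residue field).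
* [Kottwitz1986] R. E. Kottwitz, *Base change for unit elements of Hecke algebras*, Compositio Math. 60 (1986), §3.
-/

set_option autoImplicit false

noncomputable section

open MeasureTheory Measure Set Filter Topology NumberField IsDedekindDomain Matrix ValuativeRel
open scoped Matrix MatrixGroups ValuativeRel

namespace Literature.NumberTheory.Automorphic.UnitaryGroup

open Literature.NumberTheory.Automorphic Literature.NumberTheory.Automorphic.IntegralReduction
open Literature.NumberTheory.Automorphic.Liu2021.LemD1IndexedNonVacuityRamifiedConverse

/-! ## §1 Generic algebra: a unipotent element of the split orthogonal group `O₂(k)`, `char k ≠ 2`, is trivial -/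

section Generic

variable {k : Type*} [Field k]

/-- **A UNIPOTENT ELEMENT OF `O(antidiag(1,1))(k)` IS TRIVIAL** (`char k ≠ 2`): `Xᵀ·[[0,1],[1,0]]·X = [[0,1],[1,0]]` and `(X − 1)² = 0` force `X = 1`
(`2ac = 2bd = 0`, `ad + bc = 1`, `(a−1)² + bc = 0 = bc + (d−1)²`). [cite: Rogawski1990, §3.9–§3.10] [cite: Kottwitz1986, §3] -/
theorem eq_one_of_transpose_mul_swap_mul_eq_of_sq_sub_one_eq_zero (h2 : (2 : k) ≠ 0) {X : Matrix (Fin 2) (Fin 2) k}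
    (hX : Xᵀ * !![(0 : k), 1; 1, 0] * X = !![(0 : k), 1; 1, 0]) (hsq : (X - 1) ^ 2 = 0) : X = 1 := by
  -- the four scalar identities
  have e00 := congrFun (congrFun hX 0) 0
  have e01 := congrFun (congrFun hX 0) 1
  have e11 := congrFun (congrFun hX 1) 1
  have s00 := congrFun (congrFun hsq 0) 0
  have s11 := congrFun (congrFun hsq 1) 1
  simp only [pow_two, Matrix.mul_apply, Matrix.transpose_apply, Fin.sum_univ_two, Matrix.of_apply, Matrix.cons_val', Matrix.cons_val_zero,
    Matrix.cons_val_one, Matrix.empty_val', Matrix.cons_val_fin_one, Matrix.sub_apply, Matrix.one_apply_eq,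
    Matrix.one_apply_ne (show (0 : Fin 2) ≠ 1 by decide), Matrix.one_apply_ne (show (1 : Fin 2) ≠ 0 by decide), Matrix.zero_apply, mul_zero, mul_one,
    zero_add, add_zero, sub_zero] at e00 e01 e11 s00 s11
  -- `2ac = 0`, `2bd = 0`, `ad + bc = 1`
  have hac : (2 : k) * (X 0 0 * X 1 0) = 0 := by linear_combination e00
  have hbd : (2 : k) * (X 0 1 * X 1 1) = 0 := by linear_combination e11
  have had : X 0 0 * X 1 1 + X 0 1 * X 1 0 = 1 := by linear_combination e01
  replace hac : X 0 0 * X 1 0 = 0 := (mul_eq_zero.1 hac).resolve_left h2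
  replace hbd : X 0 1 * X 1 1 = 0 := (mul_eq_zero.1 hbd).resolve_left h2
  -- `a ≠ 0`
  have ha0 : X 0 0 ≠ 0 := by
    intro ha
    have had' : X 0 1 * X 1 0 = 1 := by linear_combination had - X 1 1 * ha
    have hb : X 0 1 ≠ 0 := fun h => by rw [h, zero_mul] at had'; exact zero_ne_one had'
    have hd : X 1 1 = 0 := (mul_eq_zero.1 hbd).resolve_left hb
    exact h2 (by linear_combination s11 - had' - (X 1 1 - 2) * hd)
  have hc : X 1 0 = 0 := (mul_eq_zero.1 hac).resolve_left ha0
  have had' : X 0 0 * X 1 1 = 1 := by linear_combination had - X 0 1 * hc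
  have hd0 : X 1 1 ≠ 0 := fun h => by rw [h, mul_zero] at had'; exact zero_ne_one had'
  have hb : X 0 1 = 0 := (mul_eq_zero.1 hbd).resolve_right hd0
  have ha : X 0 0 = 1 := by
    have h : (X 0 0 - 1) * (X 0 0 - 1) = 0 := by linear_combination s00 - X 0 1 * hc
    exact sub_eq_zero.1 (mul_self_eq_zero.1 h)
  have hd : X 1 1 = 1 := by
    have h : (X 1 1 - 1) * (X 1 1 - 1) = 0 := by linear_combination s11 - X 0 1 * hc
    exact sub_eq_zero.1 (mul_self_eq_zero.1 h)
  ext i j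
  fin_cases i <;> fin_cases j
  · simpa using ha
  · simpa using hb
  · simpa using hc
  · simpa using hd

end Generic

/-! ## §2 The place `w`: `σ_w` reduces to the identity at a ramified place; the reduction of `h_{2,w}` is `Φ̄₂`-orthogonal; the HEAD -/

section Place

variable (L : Type) [Field L] [NumberField L] [IsCMField L] (v : HeightOneSpectrum (𝓞 ↥(maximalRealSubfield L)))
  (w : PlacesOver L v) (hw : IsCMField.complexConj L • w.1 = w.1)

include hw in
/-- **`red (σ_w x) = red x` FOR `x ∈ 𝒪_w` AT A RAMIFIED PLACE** (`|σ_w x − x|_w < 1`, ★ `valued_galAdicCompletionMap_sub_lt_one_of_ramified`; in particular `σ_w x ∈ 𝒪_w`).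
[cite: Serre1979, Ch. I §7–§8] -/
theorem red_galAdicCompletionMap_eq_of_ramified (he : v.asIdeal.ramificationIdx' w.1.asIdeal ≠ 1) {x : w.1.adicCompletion L} (hx : x ∈ 𝒪[w.1.adicCompletion L]) :
    galAdicCompletionMap (L := L) (IsCMField.complexConj L) hw x ∈ 𝒪[w.1.adicCompletion L] ∧
      red (galAdicCompletionMap (L := L) (IsCMField.complexConj L) hw x) = red x := by
  haveI : Algebra.IsQuadraticExtension ↥(maximalRealSubfield L) L := IsCMField.isQuadraticExtension L
  have hx1 : Valued.v x ≤ 1 := (v_le_one_iff_mem_integer x).2 hx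
  have hlt := valued_galAdicCompletionMap_sub_lt_one_of_ramified L (IsCMField.complexConj L) v (IsCMField.complexConj_ne_one L) w hw he x hx1
  have hσ1 : Valued.v (galAdicCompletionMap (L := L) (IsCMField.complexConj L) hw x) ≤ 1 := by
    have h : galAdicCompletionMap (L := L) (IsCMField.complexConj L) hw x = (galAdicCompletionMap (L := L) (IsCMField.complexConj L) hw x - x) + x := by ring
    rw [h]
    exact (Valued.v.map_add _ _).trans (max_le hlt.le hx1)
  have hσO : galAdicCompletionMap (L := L) (IsCMField.complexConj L) hw x ∈ 𝒪[w.1.adicCompletion L] := (v_le_one_iff_mem_integer _).1 hσ1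
  exact ⟨hσO, red_eq_red_of_valuation_sub_lt_one hσO hx ((v_lt_one_iff_valuation_lt_one _).1 hlt)⟩

include hw in
/-- **`redMat (M.map σ_w) = redMat M` FOR AN INTEGRAL MATRIX AT A RAMIFIED PLACE** (entrywise ★ `red_galAdicCompletionMap_eq_of_ramified`). [cite: Serre1979, Ch. I §7–§8] -/
theorem redMat_map_galAdicCompletionMap_eq_of_ramified (he : v.asIdeal.ramificationIdx' w.1.asIdeal ≠ 1) {m m' : Type*}
    {M : Matrix m m' (w.1.adicCompletion L)} (hM : ∀ i j, M i j ∈ 𝒪[w.1.adicCompletion L]) :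
    redMat (M.map (galAdicCompletionMap (L := L) (IsCMField.complexConj L) hw)) = redMat M := by
  ext i j
  simp only [redMat, Matrix.map_apply]
  exact (red_galAdicCompletionMap_eq_of_ramified L v w hw he (hM i j)).2

include hw in
/-- **THE REDUCTION OF `h_{2,w}` IS `Φ̄₂`-ORTHOGONAL AT A RAMIFIED PLACE**: for `h ∈ K_H = K₂ × K₁`, the reduction `h̄` of the `w`-component of `h.1` satisfies
`h̄ᵀ·antidiag(1,1)·h̄ = antidiag(1,1)` over `𝓀_w` (unitarity `(σ_w h)ᵀ Φ₂ h = Φ₂` at `w` with `Φ₂ = antidiag(1,1)` ★ `placeForm_antidiagTwo_eq`, reduced with `σ̄_w = id`).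
[cite: Rogawski1990, §3.9–§3.10] [cite: Serre1979, Ch. I §7–§8] -/
theorem redMat_transpose_mul_swap_mul_eq_of_mem (he : v.asIdeal.ramificationIdx' w.1.asIdeal ≠ 1)
    {h : ((cmDatum L 2 (Matrix.of fun i j : Fin 2 => if i.val + j.val + 1 = 2 then (1 : L) else 0)).Local v × (cmDatum L 1 (Matrix.of fun i j : Fin 1 => if i.val + j.val + 1 = 1 then (1 : L) else 0)).Local v)}
    (hh : h ∈ (((cmLocalIntegralLevel L 2 (Matrix.of fun i j : Fin 2 => if i.val + j.val + 1 = 2 then (1 : L) else 0) v).prod (cmLocalIntegralLevel L 1 (Matrix.of fun i j : Fin 1 => if i.val + j.val + 1 = 1 then (1 : L) else 0) v) : Subgroup _) : Set _)) :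
    (redMat (((h.1.val : GL (Fin 2) (UnitaryGroup.LocalRing L v)).val.map (Pi.evalRingHom (fun w' : PlacesOver L v => w'.1.adicCompletion L) w))))ᵀ * !![(0 : 𝓀[w.1.adicCompletion L]), 1; 1, 0] *
        redMat (((h.1.val : GL (Fin 2) (UnitaryGroup.LocalRing L v)).val.map (Pi.evalRingHom (fun w' : PlacesOver L v => w'.1.adicCompletion L) w))) =
      !![(0 : 𝓀[w.1.adicCompletion L]), 1; 1, 0] := by
  set M : Matrix (Fin 2) (Fin 2) (w.1.adicCompletion L) :=
    ((h.1.val : GL (Fin 2) (UnitaryGroup.LocalRing L v)).val.map (Pi.evalRingHom (fun w' : PlacesOver L v => w'.1.adicCompletion L) w)) with hM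
  -- integrality of `M`
  have hint : ∀ a b, M a b ∈ 𝒪[w.1.adicCompletion L] := fun a b => apply_mem_integer_of_mem L v w hw hh a b
  -- unitarity of `M` at `w`: `(M.map σ_w)ᵀ * antidiag(1,1) * M = antidiag(1,1)`
  have hU := mem_unitaryGroupOfForm_iff.1 (localNonsplitEquiv (IsCMField.complexConj L) (Matrix.of fun i j : Fin 2 => if i.val + j.val + 1 = 2 then (1 : L) else 0)
    (IsCMField.complexConj_ne_one L) w hw h.1).2
  rw [coe_localNonsplitEquiv_apply L (Matrix.of fun i j : Fin 2 => if i.val + j.val + 1 = 2 then (1 : L) else 0) v w hw h.1, placeForm_antidiagTwo_eq L v w] at hU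
  change (M.map (galAdicCompletionMap (L := L) (IsCMField.complexConj L) hw))ᵀ * !![(0 : w.1.adicCompletion L), 1; 1, 0] * M = !![(0 : w.1.adicCompletion L), 1; 1, 0] at hU
  -- integrality of the other factors
  have hJint : ∀ a b, (!![(0 : w.1.adicCompletion L), 1; 1, 0]) a b ∈ 𝒪[w.1.adicCompletion L] := by
    intro a b
    fin_cases a <;> fin_cases b <;> simp [zero_mem, one_mem]
  have hσint : ∀ a b, (M.map (galAdicCompletionMap (L := L) (IsCMField.complexConj L) hw))ᵀ a b ∈ 𝒪[w.1.adicCompletion L] := fun a b =>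
    (red_galAdicCompletionMap_eq_of_ramified L v w hw he (hint b a)).1
  have vb : ∀ {N : Matrix (Fin 2) (Fin 2) (w.1.adicCompletion L)}, (∀ a b, N a b ∈ 𝒪[w.1.adicCompletion L]) → ValBound 1 N :=
    fun hN a b => (Valuation.mem_integer_iff _ _).1 (hN a b)
  -- reduce
  have hred := congrArg redMat hU
  have hprod : ValBound 1 ((M.map (galAdicCompletionMap (L := L) (IsCMField.complexConj L) hw))ᵀ * !![(0 : w.1.adicCompletion L), 1; 1, 0]) := by
    have h := ValBound.mul (vb hσint) (vb hJint)
    rwa [one_mul] at h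
  rw [redMat_mul hprod (vb hint), redMat_mul (vb hσint) (vb hJint), redMat_transpose,
    redMat_map_galAdicCompletionMap_eq_of_ramified L v w hw he hint] at hred
  have hJred : redMat (!![(0 : w.1.adicCompletion L), 1; 1, 0]) = !![(0 : 𝓀[w.1.adicCompletion L]), 1; 1, 0] := by
    have h0 : red (0 : w.1.adicCompletion L) = 0 := by
      have h : red ((0 : 𝒪[w.1.adicCompletion L]) : w.1.adicCompletion L) = 0 := by rw [red_coe, map_zero]
      exact h
    ext a b
    fin_cases a <;> fin_cases b <;> simp [redMat, Matrix.map_apply, h0, red_one]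
  rw [hJred] at hred
  exact hred

include hw in
/-- **HEAD — EVIDENCE (b) `stub_chiOne_vanishes_ram` OF THE P-1-ram SKELETON, TOKEN FOR TOKEN: `χ₁ ≡ 0` ON `K_H` AT A TAME-RAMIFIED `w`.**  Every residually-unipotent
element of `K₂ = U(Φ₂) ∩ GL₂(𝒪_w)` is residually TRIVIAL: for `h ∈ K_H = K₂ × K₁` with `(h̄ − 1)² = 0` (`h̄` the reduction of the `w`-component of `h.1`), `h̄ = 1`
(§1 on the `Φ̄₂`-orthogonality of `h̄`, `char 𝓀_w ≠ 2` from `2 ∈ 𝒪_w^×`).  Consequence: END's inert `χ₁` is the zero function on `K_H`, and `χ₀ = 1_{K_H}` on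
residually-unipotent points. [cite: Rogawski1990, §3.9–§3.10; §4.9 p. 55] [cite: Serre1979, Ch. I §7–§8] -/
theorem redMat_eq_one_of_sq_sub_one_eq_zero_of_ramified (he : v.asIdeal.ramificationIdx' w.1.asIdeal ≠ 1)
    (h2 : IsUnit (2 : 𝒪[(w.1.adicCompletion L)]))
    (h : ((cmDatum L 2 (Matrix.of fun i j : Fin 2 => if i.val + j.val + 1 = 2 then (1 : L) else 0)).Local v × (cmDatum L 1 (Matrix.of fun i j : Fin 1 => if i.val + j.val + 1 = 1 then (1 : L) else 0)).Local v)) (hh : h ∈ (((cmLocalIntegralLevel L 2 (Matrix.of fun i j : Fin 2 => if i.val + j.val + 1 = 2 then (1 : L) else 0) v).prod (cmLocalIntegralLevel L 1 (Matrix.of fun i j : Fin 1 => if i.val + j.val + 1 = 1 then (1 : L) else 0) v) : Subgroup _) : Set _))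
    (hunip : (redMat (((h.1.val : GL (Fin 2) (UnitaryGroup.LocalRing L v)).val.map (Pi.evalRingHom (fun w' : PlacesOver L v => w'.1.adicCompletion L) w))) - 1) ^ 2 = 0) :
    redMat (((h.1.val : GL (Fin 2) (UnitaryGroup.LocalRing L v)).val.map (Pi.evalRingHom (fun w' : PlacesOver L v => w'.1.adicCompletion L) w))) = 1 := by
  have h2k : (2 : 𝓀[w.1.adicCompletion L]) ≠ 0 := by
    have hu : IsUnit (IsLocalRing.residue 𝒪[(w.1.adicCompletion L)] 2) := h2.map _
    rw [map_ofNat] at hu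
    exact hu.ne_zero
  exact eq_one_of_transpose_mul_swap_mul_eq_of_sq_sub_one_eq_zero h2k (redMat_transpose_mul_swap_mul_eq_of_mem L v w hw he hh) hunip

end Place

end Literature.NumberTheory.Automorphic.UnitaryGroup

end
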